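import Summits.CriticalPhenomena.Ising3DConformalLimit.Theorems.FKParityRobustnessStrandShadowComposition
import Literature.Probability.LatticeModels.GKSInequalities
import Literature.Probability.LatticeModels.LoopO1
import HarnessLib

/-!
# Paley–Zygmund core of the line `loop-footprint-strand-mass` (crux `StrandShadow`, stmt-CriticalPhenomena-14626)

Support file (lead prover-line-stmt-CriticalPhenomena-14626-c1-0).  On ANY finite graph, at `t = tanh β > 0`,
for four marked vertices `a` and an edge window `B`: the two FOOTPRINT FLOORS (instances of the landed
one-edge-law/fibre theorem `footprintFloor`, taken here as hypotheses `hfoot₁`, `hfoot₂`), a THERMAL OVERLAP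
FLOOR with constant `m₀` (`hfloor`, the shape of the line's open stub `stub_thermalOverlapFloor`) and an
OVERLAP CEILING with constant `C` (`hceil`, the shape of the open stub `stub_overlapCeiling`) give a uniform
lower bound on the joint `T`-join mass of the meeting event,
`jointSum ≥ c₁·Z₀₁Z₂₃`, `c₁ = m/(C(m+1))`, `m = (t/(1−t²))²·m₀` (`joint_lower_core`):
footprint + GKS II make the first moment of the window overlap `N = |E(K₁) ∩ E(K₂) ∩ B|` of two
independent source clusters at least `m·Z₀₁Z₂₃` (`firstMoment_eq_edgeSum`, Fubini), the weighted
Cauchy–Schwarz / Paley–Zygmund step (`cs_weighted`, `joint_lower_of_moments`) and "a shared cluster edge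
joins `a₀` to `a₂` in `F₁ ∪ F₂`" (`reachable_of_shared_edge`) do the rest.  Dimension-free; the d = 3
content of the line lives entirely in the two lattice stubs.
-/

noncomputable section

open Finset SimpleGraph
open Literature.Probability.LatticeModels
open Summit.CriticalPhenomena.Ising3DConformalLimit.Theorems

namespace Summit.CriticalPhenomena.Ising3DConformalLimit.Theorems.StrandShadowFootprint

open scoped Classical symmDiff

section Arith

/-- Weighted Cauchy–Schwarz: `(Σ w N)² ≤ (Σ w N²)·(Σ_{N ≠ 0} w)` for weights `w ≥ 0`
(the Paley–Zygmund numerator/denominator; the `Decidable` instance is unified from the goal). -/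
theorem cs_weighted {ι : Type*} (s : Finset ι) (w N : ι → ℝ) {instN : ∀ i, Decidable (N i = 0)}
    (hw : ∀ i ∈ s, 0 ≤ w i) :
    (∑ i ∈ s, w i * N i) ^ 2 ≤
      (∑ i ∈ s, w i * N i ^ 2) * ∑ i ∈ s, (if N i = 0 then 0 else w i) := by
  refine Finset.sum_sq_le_sum_mul_sum_of_sq_le_mul s
    (fun i hi => mul_nonneg (hw i hi) (sq_nonneg _)) (fun i hi => ?_) (fun i hi => ?_)
  · split_ifs
    · exact le_rfl
    · exact hw i hi
  · split_ifs with h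
    · rw [h]; simp
    · exact le_of_eq (by ring)

/-- The real arithmetic of Paley–Zygmund with a first-moment floor `m·Z ≤ M₁` and a
second-moment ceiling `M₂·Z ≤ C(M₁² + M₁Z)`: `JS ≥ (m/(C(m+1)))·Z`. -/
theorem joint_lower_of_moments {JS M₁ M₂ Z m C : ℝ} (hJS : 0 ≤ JS) (hZ : 0 ≤ Z) (hm : 0 < m)
    (hC : 0 < C) (hCS : M₁ ^ 2 ≤ M₂ * JS) (hceil : M₂ * Z ≤ C * (M₁ ^ 2 + M₁ * Z))
    (hfloor : m * Z ≤ M₁) : m / (C * (m + 1)) * Z ≤ JS := by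
  rcases hZ.eq_or_lt with hZ0 | hZpos
  · rw [← hZ0, mul_zero]; exact hJS
  have hM₁ : 0 < M₁ := lt_of_lt_of_le (mul_pos hm hZpos) hfloor
  have hZle : Z ≤ M₁ / m := by
    rw [le_div_iff₀ hm]; linarith
  have h1 : M₁ * Z ≤ M₁ ^ 2 / m := by
    calc M₁ * Z ≤ M₁ * (M₁ / m) := mul_le_mul_of_nonneg_left hZle hM₁.le
      _ = M₁ ^ 2 / m := by ring
  have h2 : M₂ * Z ≤ C * (1 + 1 / m) * M₁ ^ 2 := by
    calc M₂ * Z ≤ C * (M₁ ^ 2 + M₁ * Z) := hceil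
      _ ≤ C * (M₁ ^ 2 + M₁ ^ 2 / m) := mul_le_mul_of_nonneg_left (by linarith) hC.le
      _ = C * (1 + 1 / m) * M₁ ^ 2 := by ring
  have h3 : M₁ ^ 2 * Z ≤ M₁ ^ 2 * (C * (1 + 1 / m) * JS) := by
    calc M₁ ^ 2 * Z ≤ M₂ * JS * Z := mul_le_mul_of_nonneg_right hCS hZ
      _ = M₂ * Z * JS := by ring
      _ ≤ C * (1 + 1 / m) * M₁ ^ 2 * JS := mul_le_mul_of_nonneg_right h2 hJS
      _ = M₁ ^ 2 * (C * (1 + 1 / m) * JS) := by ring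
  have h4 : Z ≤ C * (1 + 1 / m) * JS := le_of_mul_le_mul_left h3 (by positivity)
  have hm' : m ≠ 0 := hm.ne'
  have hC' : C ≠ 0 := hC.ne'
  have hm1 : m + 1 ≠ 0 := (by linarith : (0 : ℝ) < m + 1).ne'
  calc m / (C * (m + 1)) * Z ≤ m / (C * (m + 1)) * (C * (1 + 1 / m) * JS) :=
        mul_le_mul_of_nonneg_left h4 (by positivity)
    _ = JS := by field_simp

/-- The final real arithmetic of the line: junk split + clean bound + junk margin. -/
theorem shadow_of_clean_junk {L Lc J Z Gc c₁ κ : ℝ} (hL : L = Lc + J)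
    (hclean : Lc ≤ (1 - 2 / 3 * c₁) * Z * Gc) (hjunk : J ≤ κ * (Z * Gc - Lc)) (hκ : κ < 1) :
    L ≤ (1 - (1 - κ) * (2 / 3 * c₁)) * Z * Gc := by
  have hκ' : 0 ≤ 1 - κ := by linarith
  have h5 : (1 - κ) * Lc ≤ (1 - κ) * ((1 - 2 / 3 * c₁) * Z * Gc) :=
    mul_le_mul_of_nonneg_left hclean hκ'
  rw [hL]
  linarith [hjunk, h5]

end Arith

section Fubini

/-- **First moment of the overlap as an edge sum** (Fubini): the weighted count of window
edges lying in both clusters equals the edge sum of the products of the two cluster weights.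
(`Decidable` instances are implicit binders, unified from the goal.) -/
theorem firstMoment_eq_edgeSum {ι₁ ι₂ ε : Type*} (T₁ : Finset ι₁) (T₂ : Finset ι₂) (B : Finset ε)
    (w₁ : ι₁ → ℝ) (w₂ : ι₂ → ℝ) (P₁ : ι₁ → ε → Prop) (P₂ : ι₂ → ε → Prop)
    {instP : ∀ F₁ F₂, DecidablePred fun e => P₁ F₁ e ∧ P₂ F₂ e}
    {instQ₁ : ∀ e, DecidablePred fun F₁ => P₁ F₁ e}
    {instQ₂ : ∀ e, DecidablePred fun F₂ => P₂ F₂ e} :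
    (∑ F₁ ∈ T₁, ∑ F₂ ∈ T₂, w₁ F₁ * w₂ F₂ * ((B.filter fun e => P₁ F₁ e ∧ P₂ F₂ e).card : ℝ))
      = ∑ e ∈ B, (∑ F₁ ∈ T₁.filter (fun F₁ => P₁ F₁ e), w₁ F₁) *
          (∑ F₂ ∈ T₂.filter (fun F₂ => P₂ F₂ e), w₂ F₂) := by
  have hcard : ∀ F₁ F₂, w₁ F₁ * w₂ F₂ * ((B.filter fun e => P₁ F₁ e ∧ P₂ F₂ e).card : ℝ) =
      ∑ e ∈ B, (if P₁ F₁ e then w₁ F₁ else 0) * (if P₂ F₂ e then w₂ F₂ else 0) := by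
    intro F₁ F₂
    rw [Finset.card_filter, Nat.cast_sum, Finset.mul_sum]
    refine Finset.sum_congr rfl fun e _ => ?_
    by_cases h1 : P₁ F₁ e
    · by_cases h2 : P₂ F₂ e
      · rw [if_pos ⟨h1, h2⟩, if_pos h1, if_pos h2]; push_cast; ring
      · rw [if_neg (fun h => h2 h.2), if_pos h1, if_neg h2]; push_cast; ring
    · rw [if_neg (fun h => h1 h.1), if_neg h1]; push_cast; ring
  calc (∑ F₁ ∈ T₁, ∑ F₂ ∈ T₂, w₁ F₁ * w₂ F₂ * ((B.filter fun e => P₁ F₁ e ∧ P₂ F₂ e).card : ℝ))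
      = ∑ F₁ ∈ T₁, ∑ F₂ ∈ T₂, ∑ e ∈ B,
          (if P₁ F₁ e then w₁ F₁ else 0) * (if P₂ F₂ e then w₂ F₂ else 0) := by
        refine Finset.sum_congr rfl fun F₁ _ => Finset.sum_congr rfl fun F₂ _ => hcard F₁ F₂
    _ = ∑ F₁ ∈ T₁, ∑ e ∈ B, ∑ F₂ ∈ T₂,
          (if P₁ F₁ e then w₁ F₁ else 0) * (if P₂ F₂ e then w₂ F₂ else 0) := by
        refine Finset.sum_congr rfl fun F₁ _ => Finset.sum_comm
    _ = ∑ e ∈ B, ∑ F₁ ∈ T₁, ∑ F₂ ∈ T₂,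
          (if P₁ F₁ e then w₁ F₁ else 0) * (if P₂ F₂ e then w₂ F₂ else 0) := Finset.sum_comm
    _ = ∑ e ∈ B, (∑ F₁ ∈ T₁.filter (fun F₁ => P₁ F₁ e), w₁ F₁) *
          (∑ F₂ ∈ T₂.filter (fun F₂ => P₂ F₂ e), w₂ F₂) := by
        refine Finset.sum_congr rfl fun e _ => ?_
        rw [Finset.sum_filter, Finset.sum_filter, Finset.sum_mul_sum]

/-- A window edge lying in the `x`-cluster of `F₁` and in the `z`-cluster of `F₂` joins `x` to
`z` inside `F₁ ∪ F₂`. -/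
theorem reachable_of_shared_edge {V : Type*} {F₁ F₂ : Finset (Sym2 V)} {x z : V} {e : Sym2 V}
    (h₁ : ∀ w ∈ e, (SimpleGraph.fromEdgeSet (↑F₁ : Set (Sym2 V))).Reachable x w)
    (h₂ : ∀ w ∈ e, (SimpleGraph.fromEdgeSet (↑F₂ : Set (Sym2 V))).Reachable z w) :
    (SimpleGraph.fromEdgeSet ((↑F₁ : Set (Sym2 V)) ∪ ↑F₂)).Reachable x z := by
  obtain ⟨w, hw⟩ : ∃ w, w ∈ e := by
    induction e using Sym2.ind with
    | _ u v => exact ⟨u, Sym2.mem_mk_left u v⟩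
  exact ((h₁ w hw).mono (fromEdgeSet_mono Set.subset_union_left)).trans
    ((h₂ w hw).mono (fromEdgeSet_mono Set.subset_union_right)).symm

end Fubini

section Core

variable {V : Type*} [Fintype V] [DecidableEq V] (G : SimpleGraph V) [DecidableRel G.Adj]

/-- **Finite-graph core of the Paley–Zygmund chain.**  On any finite graph, at `t = tanh β > 0`:
the two footprint floors (instances of `stub_footprintFloor` at the two source pairs), a thermal
overlap floor with constant `m₀` (the shape of `stub_thermalOverlapFloor`) and an overlap
ceiling with constant `C` (the shape of `stub_overlapCeiling`) on a window `B` give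
`jointSum ≥ c₁·Z₀₁Z₂₃` with `c₁ = m/(C(m+1))`, `m = (t/(1−t²))²·m₀`. -/
theorem joint_lower_core {β m₀ C : ℝ} (hβ : 0 ≤ β) (ht0 : 0 < Real.tanh β) (hm₀ : 0 < m₀)
    (hC : 0 < C) (a : Fin 4 → V) (B : Finset (Sym2 V))
    (hfoot₁ : ∀ e ∈ B,
      Real.tanh β * (loopO1PartitionFunction G (Real.tanh β) ∅ *
            loopO1PartitionFunction G (Real.tanh β)
              (({a 0, a 1} : Finset V) ∆ (Finset.univ.filter fun w : V => w ∈ e))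
          - loopO1PartitionFunction G (Real.tanh β) {a 0, a 1} *
            loopO1PartitionFunction G (Real.tanh β) (Finset.univ.filter fun w : V => w ∈ e))
        ≤ (1 - Real.tanh β ^ 2) * loopO1PartitionFunction G (Real.tanh β) ∅ *
          ∑ F ∈ (tJoins G Set.univ {a 0, a 1}).filter (fun F : Finset (Sym2 V) =>
              e ∈ F ∧ ∀ w ∈ e, (SimpleGraph.fromEdgeSet (↑F : Set (Sym2 V))).Reachable (a 0) w),
            Real.tanh β ^ F.card)
    (hfoot₂ : ∀ e ∈ B,
      Real.tanh β * (loopO1PartitionFunction G (Real.tanh β) ∅ *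
            loopO1PartitionFunction G (Real.tanh β)
              (({a 2, a 3} : Finset V) ∆ (Finset.univ.filter fun w : V => w ∈ e))
          - loopO1PartitionFunction G (Real.tanh β) {a 2, a 3} *
            loopO1PartitionFunction G (Real.tanh β) (Finset.univ.filter fun w : V => w ∈ e))
        ≤ (1 - Real.tanh β ^ 2) * loopO1PartitionFunction G (Real.tanh β) ∅ *
          ∑ F ∈ (tJoins G Set.univ {a 2, a 3}).filter (fun F : Finset (Sym2 V) =>
              e ∈ F ∧ ∀ w ∈ e, (SimpleGraph.fromEdgeSet (↑F : Set (Sym2 V))).Reachable (a 2) w),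
            Real.tanh β ^ F.card)
    (hfloor : m₀ * (isingCorr G Finset.univ β 0 .free {a 0, a 1} *
        isingCorr G Finset.univ β 0 .free {a 2, a 3}) ≤
      ∑ e ∈ B,
        (isingCorr G Finset.univ β 0 .free
              (({a 0, a 1} : Finset V) ∆ (Finset.univ.filter fun w : V => w ∈ e))
            - isingCorr G Finset.univ β 0 .free {a 0, a 1} *
              isingCorr G Finset.univ β 0 .free (Finset.univ.filter fun w : V => w ∈ e)) *
        (isingCorr G Finset.univ β 0 .free
              (({a 2, a 3} : Finset V) ∆ (Finset.univ.filter fun w : V => w ∈ e))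
            - isingCorr G Finset.univ β 0 .free {a 2, a 3} *
              isingCorr G Finset.univ β 0 .free (Finset.univ.filter fun w : V => w ∈ e)))
    (hceil :
      (∑ F₁ ∈ tJoins G Set.univ {a 0, a 1}, ∑ F₂ ∈ tJoins G Set.univ {a 2, a 3},
          Real.tanh β ^ (F₁.card + F₂.card) *
            ((B.filter fun e =>
                (e ∈ F₁ ∧ ∀ w ∈ e, (SimpleGraph.fromEdgeSet (↑F₁ : Set (Sym2 V))).Reachable (a 0) w) ∧
                (e ∈ F₂ ∧ ∀ w ∈ e, (SimpleGraph.fromEdgeSet (↑F₂ : Set (Sym2 V))).Reachable (a 2) w)).card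
              : ℝ) ^ 2) *
        (loopO1PartitionFunction G (Real.tanh β) {a 0, a 1} *
          loopO1PartitionFunction G (Real.tanh β) {a 2, a 3}) ≤
      C * ((∑ F₁ ∈ tJoins G Set.univ {a 0, a 1}, ∑ F₂ ∈ tJoins G Set.univ {a 2, a 3},
              Real.tanh β ^ (F₁.card + F₂.card) *
                ((B.filter fun e =>
                    (e ∈ F₁ ∧ ∀ w ∈ e, (SimpleGraph.fromEdgeSet (↑F₁ : Set (Sym2 V))).Reachable (a 0) w) ∧
                    (e ∈ F₂ ∧ ∀ w ∈ e, (SimpleGraph.fromEdgeSet (↑F₂ : Set (Sym2 V))).Reachable (a 2) w)).card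
                  : ℝ)) ^ 2 +
            (∑ F₁ ∈ tJoins G Set.univ {a 0, a 1}, ∑ F₂ ∈ tJoins G Set.univ {a 2, a 3},
              Real.tanh β ^ (F₁.card + F₂.card) *
                ((B.filter fun e =>
                    (e ∈ F₁ ∧ ∀ w ∈ e, (SimpleGraph.fromEdgeSet (↑F₁ : Set (Sym2 V))).Reachable (a 0) w) ∧
                    (e ∈ F₂ ∧ ∀ w ∈ e, (SimpleGraph.fromEdgeSet (↑F₂ : Set (Sym2 V))).Reachable (a 2) w)).card
                  : ℝ)) *
            (loopO1PartitionFunction G (Real.tanh β) {a 0, a 1} *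
              loopO1PartitionFunction G (Real.tanh β) {a 2, a 3}))) :
    (Real.tanh β / (1 - Real.tanh β ^ 2)) ^ 2 * m₀ /
        (C * ((Real.tanh β / (1 - Real.tanh β ^ 2)) ^ 2 * m₀ + 1)) *
      (loopO1PartitionFunction G (Real.tanh β) {a 0, a 1} *
        loopO1PartitionFunction G (Real.tanh β) {a 2, a 3}) ≤
    ∑ F₁ ∈ tJoins G Set.univ {a 0, a 1}, ∑ F₂ ∈ tJoins G Set.univ {a 2, a 3},
      if (SimpleGraph.fromEdgeSet ((↑F₁ : Set (Sym2 V)) ∪ ↑F₂)).Reachable (a 0) (a 2)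
      then Real.tanh β ^ (F₁.card + F₂.card) else 0 := by
  -- abbreviations (closed terms only; predicates stay verbatim so that instances coincide)
  set t := Real.tanh β with ht_def
  set Z0 := loopO1PartitionFunction G t ∅ with hZ0_def
  set Z01 := loopO1PartitionFunction G t {a 0, a 1} with hZ01_def
  set Z23 := loopO1PartitionFunction G t {a 2, a 3} with hZ23_def
  set T₁ := tJoins G Set.univ {a 0, a 1} with hT₁_def
  set T₂ := tJoins G Set.univ {a 2, a 3} with hT₂_def
  set c01 := isingCorr G Finset.univ β 0 .free {a 0, a 1} with hc01_def
  set c23 := isingCorr G Finset.univ β 0 .free {a 2, a 3} with hc23_def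
  set Nov : Finset (Sym2 V) → Finset (Sym2 V) → ℝ := fun F₁ F₂ =>
    ((B.filter fun e =>
        (e ∈ F₁ ∧ ∀ w ∈ e, (SimpleGraph.fromEdgeSet (↑F₁ : Set (Sym2 V))).Reachable (a 0) w) ∧
        (e ∈ F₂ ∧ ∀ w ∈ e, (SimpleGraph.fromEdgeSet (↑F₂ : Set (Sym2 V))).Reachable (a 2) w)).card : ℝ)
    with hNov_def
  set M₁ : ℝ := ∑ F₁ ∈ T₁, ∑ F₂ ∈ T₂, t ^ (F₁.card + F₂.card) * Nov F₁ F₂ with hM₁_def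
  set M₂ : ℝ := ∑ F₁ ∈ T₁, ∑ F₂ ∈ T₂, t ^ (F₁.card + F₂.card) * Nov F₁ F₂ ^ 2 with hM₂_def
  set JS : ℝ := ∑ F₁ ∈ T₁, ∑ F₂ ∈ T₂,
    (if (SimpleGraph.fromEdgeSet ((↑F₁ : Set (Sym2 V)) ∪ ↑F₂)).Reachable (a 0) (a 2)
      then t ^ (F₁.card + F₂.card) else 0) with hJS_def
  set X₁ : Sym2 V → ℝ := fun e => ∑ F ∈ T₁.filter (fun F : Finset (Sym2 V) =>
      e ∈ F ∧ ∀ w ∈ e, (SimpleGraph.fromEdgeSet (↑F : Set (Sym2 V))).Reachable (a 0) w),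
    t ^ F.card with hX₁_def
  set X₂ : Sym2 V → ℝ := fun e => ∑ F ∈ T₂.filter (fun F : Finset (Sym2 V) =>
      e ∈ F ∧ ∀ w ∈ e, (SimpleGraph.fromEdgeSet (↑F : Set (Sym2 V))).Reachable (a 2) w),
    t ^ F.card with hX₂_def
  set D₁ : Sym2 V → ℝ := fun e =>
    isingCorr G Finset.univ β 0 .free
        (({a 0, a 1} : Finset V) ∆ (Finset.univ.filter fun w : V => w ∈ e))
      - c01 * isingCorr G Finset.univ β 0 .free (Finset.univ.filter fun w : V => w ∈ e)
    with hD₁_def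
  set D₂ : Sym2 V → ℝ := fun e =>
    isingCorr G Finset.univ β 0 .free
        (({a 2, a 3} : Finset V) ∆ (Finset.univ.filter fun w : V => w ∈ e))
      - c23 * isingCorr G Finset.univ β 0 .free (Finset.univ.filter fun w : V => w ∈ e)
    with hD₂_def
  -- signs and positivity
  have ht : 0 ≤ t := ht0.le
  have ht1 : t < 1 := Real.tanh_lt_one β
  have h1t : 0 < 1 - t ^ 2 := by nlinarith
  have h1t' : 1 - t ^ 2 ≠ 0 := h1t.ne'
  have hZ0 : 0 < Z0 := loopO1PartitionFunction_empty_pos G ht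
  have hZ01 : 0 ≤ Z01 := loopO1PartitionFunction_nonneg G ht _
  have hZ23 : 0 ≤ Z23 := loopO1PartitionFunction_nonneg G ht _
  have hX₁ : ∀ e, 0 ≤ X₁ e := fun e => Finset.sum_nonneg fun F _ => pow_nonneg ht _
  have hX₂ : ∀ e, 0 ≤ X₂ e := fun e => Finset.sum_nonneg fun F _ => pow_nonneg ht _
  -- HT dictionary `⟨σ_A⟩·Z⁰ = Z^A` and the GKS II sign of the truncations
  have hd : ∀ A : Finset V, isingCorr G Finset.univ β 0 .free A * Z0 =
      loopO1PartitionFunction G t A :=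
    fun A => StrandShadowSketch.isingCorr_univ_mul_loopO1_empty G β A
  have hgks : ∀ S E : Finset V, isingCorr G Finset.univ β 0 .free S *
      isingCorr G Finset.univ β 0 .free E ≤ isingCorr G Finset.univ β 0 .free (S ∆ E) :=
    fun S E => GKSInequalities.gks_two_holds G (Λ := Finset.univ) (A := S) (B := E) (β := β)
      (h := 0) (bc := .free) hβ le_rfl (Or.inl rfl) (Finset.subset_univ _) (Finset.subset_univ _)
  have hD₁ : ∀ e, 0 ≤ D₁ e := fun e => sub_nonneg.2 (hgks _ _)
  have hD₂ : ∀ e, 0 ≤ D₂ e := fun e => sub_nonneg.2 (hgks _ _)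
  -- Step 1: edgewise, `X_i(e) ≥ κ₀·D_i(e)` with `κ₀ = t·Z⁰/(1−t²)`
  set κ₀ : ℝ := t * Z0 / (1 - t ^ 2) with hκ₀_def
  have hκ₀ : 0 ≤ κ₀ := div_nonneg (mul_nonneg ht hZ0.le) h1t.le
  have hstep : ∀ (S : Finset V) (x : V) (e : Sym2 V),
      t * (Z0 * loopO1PartitionFunction G t (S ∆ (Finset.univ.filter fun w : V => w ∈ e))
          - loopO1PartitionFunction G t S *
            loopO1PartitionFunction G t (Finset.univ.filter fun w : V => w ∈ e))
        ≤ (1 - t ^ 2) * Z0 *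
          ∑ F ∈ (tJoins G Set.univ S).filter (fun F : Finset (Sym2 V) =>
              e ∈ F ∧ ∀ w ∈ e, (SimpleGraph.fromEdgeSet (↑F : Set (Sym2 V))).Reachable x w),
            t ^ F.card →
      κ₀ * (isingCorr G Finset.univ β 0 .free (S ∆ (Finset.univ.filter fun w : V => w ∈ e))
          - isingCorr G Finset.univ β 0 .free S *
            isingCorr G Finset.univ β 0 .free (Finset.univ.filter fun w : V => w ∈ e))
        ≤ ∑ F ∈ (tJoins G Set.univ S).filter (fun F : Finset (Sym2 V) =>
              e ∈ F ∧ ∀ w ∈ e, (SimpleGraph.fromEdgeSet (↑F : Set (Sym2 V))).Reachable x w),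
            t ^ F.card := by
    intro S x e h
    have eSE := hd (S ∆ (Finset.univ.filter fun w : V => w ∈ e))
    have eS := hd S
    have eE := hd (Finset.univ.filter fun w : V => w ∈ e)
    rw [← eSE, ← eS, ← eE] at h
    -- h : t * (Z0 * (cSE * Z0) - cS * Z0 * (cE * Z0)) ≤ (1 - t²) * Z0 * X
    have h' : (t * Z0) *
        (isingCorr G Finset.univ β 0 .free (S ∆ (Finset.univ.filter fun w : V => w ∈ e))
          - isingCorr G Finset.univ β 0 .free S *
            isingCorr G Finset.univ β 0 .free (Finset.univ.filter fun w : V => w ∈ e)) * Z0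
        ≤ ((1 - t ^ 2) *
          ∑ F ∈ (tJoins G Set.univ S).filter (fun F : Finset (Sym2 V) =>
              e ∈ F ∧ ∀ w ∈ e, (SimpleGraph.fromEdgeSet (↑F : Set (Sym2 V))).Reachable x w),
            t ^ F.card) * Z0 := by
      refine le_trans (le_of_eq ?_) (le_trans h (le_of_eq ?_)) <;> ring
    have h'' := le_of_mul_le_mul_right h' hZ0
    rw [hκ₀_def, div_mul_eq_mul_div, div_le_iff₀ h1t]
    linarith [h'']
  have hE₁ : ∀ e ∈ B, κ₀ * D₁ e ≤ X₁ e := fun e he => hstep {a 0, a 1} (a 0) e (hfoot₁ e he)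
  have hE₂ : ∀ e ∈ B, κ₀ * D₂ e ≤ X₂ e := fun e he => hstep {a 2, a 3} (a 2) e (hfoot₂ e he)
  -- Step 2: first moment `M₁ = Σ_e X₁X₂ ≥ κ₀²·Σ_e D₁D₂ ≥ κ₀²·m₀·c₀₁c₂₃ = m·Z₀₁Z₂₃`
  have hF : (∑ F₁ ∈ T₁, ∑ F₂ ∈ T₂, t ^ F₁.card * t ^ F₂.card * Nov F₁ F₂)
      = ∑ e ∈ B, X₁ e * X₂ e :=
    firstMoment_eq_edgeSum T₁ T₂ B (fun F : Finset (Sym2 V) => t ^ F.card)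
      (fun F : Finset (Sym2 V) => t ^ F.card)
      (fun (F : Finset (Sym2 V)) (e : Sym2 V) =>
        e ∈ F ∧ ∀ w ∈ e, (SimpleGraph.fromEdgeSet (↑F : Set (Sym2 V))).Reachable (a 0) w)
      (fun (F : Finset (Sym2 V)) (e : Sym2 V) =>
        e ∈ F ∧ ∀ w ∈ e, (SimpleGraph.fromEdgeSet (↑F : Set (Sym2 V))).Reachable (a 2) w)
  have hM₁eq : M₁ = ∑ e ∈ B, X₁ e * X₂ e := by
    rw [← hF, hM₁_def]
    refine Finset.sum_congr rfl fun F₁ _ => Finset.sum_congr rfl fun F₂ _ => ?_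
    rw [pow_add]
  have hfloorM : (t / (1 - t ^ 2)) ^ 2 * m₀ * (Z01 * Z23) ≤ M₁ := by
    have hsum : ∑ e ∈ B, κ₀ ^ 2 * (D₁ e * D₂ e) ≤ ∑ e ∈ B, X₁ e * X₂ e := by
      refine Finset.sum_le_sum fun e he => ?_
      calc κ₀ ^ 2 * (D₁ e * D₂ e) = (κ₀ * D₁ e) * (κ₀ * D₂ e) := by ring
        _ ≤ X₁ e * X₂ e :=
          mul_le_mul (hE₁ e he) (hE₂ e he) (mul_nonneg hκ₀ (hD₂ e)) (hX₁ e)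
    rw [← Finset.mul_sum] at hsum
    have hfl : κ₀ ^ 2 * (m₀ * (c01 * c23)) ≤ κ₀ ^ 2 * ∑ e ∈ B, D₁ e * D₂ e :=
      mul_le_mul_of_nonneg_left hfloor (sq_nonneg _)
    have hZ01' : Z01 = c01 * Z0 := (hd {a 0, a 1}).symm
    have hZ23' : Z23 = c23 * Z0 := (hd {a 2, a 3}).symm
    have hid : (t / (1 - t ^ 2)) ^ 2 * m₀ * (Z01 * Z23) = κ₀ ^ 2 * (m₀ * (c01 * c23)) := by
      rw [hZ01', hZ23', hκ₀_def]
      field_simp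
    rw [hid, hM₁eq]
    exact hfl.trans hsum
  -- Step 3: Cauchy–Schwarz on the product index set and `N ≥ 1 ⇒ a₀ ↝ a₂`
  have hTw : ∀ p ∈ T₁ ×ˢ T₂, 0 ≤ t ^ (p.1.card + p.2.card) := fun p _ => pow_nonneg ht _
  have hCS0 : (∑ p ∈ T₁ ×ˢ T₂, t ^ (p.1.card + p.2.card) * Nov p.1 p.2) ^ 2 ≤
      (∑ p ∈ T₁ ×ˢ T₂, t ^ (p.1.card + p.2.card) * Nov p.1 p.2 ^ 2) *
        ∑ p ∈ T₁ ×ˢ T₂, (if Nov p.1 p.2 = 0 then 0 else t ^ (p.1.card + p.2.card)) :=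
    cs_weighted (T₁ ×ˢ T₂) (fun p => t ^ (p.1.card + p.2.card)) (fun p => Nov p.1 p.2) hTw
  have hM₁prod : ∑ p ∈ T₁ ×ˢ T₂, t ^ (p.1.card + p.2.card) * Nov p.1 p.2 = M₁ :=
    Finset.sum_product' T₁ T₂ (fun F₁ F₂ => t ^ (F₁.card + F₂.card) * Nov F₁ F₂)
  have hM₂prod : ∑ p ∈ T₁ ×ˢ T₂, t ^ (p.1.card + p.2.card) * Nov p.1 p.2 ^ 2 = M₂ :=
    Finset.sum_product' T₁ T₂ (fun F₁ F₂ => t ^ (F₁.card + F₂.card) * Nov F₁ F₂ ^ 2)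
  have hJSprod : ∑ p ∈ T₁ ×ˢ T₂,
      (if (SimpleGraph.fromEdgeSet ((↑p.1 : Set (Sym2 V)) ∪ ↑p.2)).Reachable (a 0) (a 2)
        then t ^ (p.1.card + p.2.card) else 0) = JS :=
    Finset.sum_product' T₁ T₂ (fun F₁ F₂ =>
      if (SimpleGraph.fromEdgeSet ((↑F₁ : Set (Sym2 V)) ∪ ↑F₂)).Reachable (a 0) (a 2)
        then t ^ (F₁.card + F₂.card) else 0)
  have hind : ∑ p ∈ T₁ ×ˢ T₂, (if Nov p.1 p.2 = 0 then 0 else t ^ (p.1.card + p.2.card))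
      ≤ JS := by
    rw [← hJSprod]
    refine Finset.sum_le_sum fun p hp => ?_
    by_cases hN : Nov p.1 p.2 = 0
    · rw [if_pos hN]
      split_ifs
      · exact pow_nonneg ht _
      · exact le_rfl
    · rw [if_neg hN]
      have hne : (B.filter fun e =>
          (e ∈ p.1 ∧ ∀ w ∈ e, (SimpleGraph.fromEdgeSet (↑p.1 : Set (Sym2 V))).Reachable (a 0) w) ∧
          (e ∈ p.2 ∧ ∀ w ∈ e, (SimpleGraph.fromEdgeSet (↑p.2 : Set (Sym2 V))).Reachable (a 2) w)).Nonempty := by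
        rw [Finset.nonempty_iff_ne_empty]
        intro h0
        apply hN
        simp only [hNov_def, h0, Finset.card_empty, Nat.cast_zero]
      obtain ⟨e, he⟩ := hne
      rw [Finset.mem_filter] at he
      obtain ⟨-, ⟨-, h1⟩, ⟨-, h2⟩⟩ := he
      rw [if_pos (reachable_of_shared_edge h1 h2)]
  have hJS0 : 0 ≤ JS := by
    refine Finset.sum_nonneg fun F₁ _ => Finset.sum_nonneg fun F₂ _ => ?_
    split_ifs
    · exact pow_nonneg ht _
    · exact le_rfl
  have hM₂0 : 0 ≤ M₂ :=
    Finset.sum_nonneg fun F₁ _ => Finset.sum_nonneg fun F₂ _ =>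
      mul_nonneg (pow_nonneg ht _) (sq_nonneg _)
  have hCS : M₁ ^ 2 ≤ M₂ * JS := by
    rw [hM₁prod, hM₂prod] at hCS0
    exact hCS0.trans (mul_le_mul_of_nonneg_left hind hM₂0)
  -- Step 4: the real arithmetic
  have hm : 0 < (t / (1 - t ^ 2)) ^ 2 * m₀ := mul_pos (pow_pos (div_pos ht0 h1t) 2) hm₀
  exact joint_lower_of_moments hJS0 (mul_nonneg hZ01 hZ23) hm hC hCS hceil hfloorM

end Core

end Summit.CriticalPhenomena.Ising3DConformalLimit.Theorems.StrandShadowFootprint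

end
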